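import Literature.AnabelianGeometry.EtaleTheta.Discharge.Sec4MuTorsionThetaTwistTower
import HarnessLib

/-!
# [EtTh] Def. 4.1 (iv): `μ_N`-SATURATED OBJECTS EXIST at the FOURTH tower model, for every `N ≥ 1` (∃-form)

S. Mochizuki, *The étale theta function …*, Publ. RIMS **45** (2009) [MochizukiEtTh2009], Def. 4.1 (iv) p.313 (PDF p.87) («We shall say
that `A` is `μ_N`-saturated if the abstract group `μ_N(A)` is isomorphic to `ℤ/Nℤ`»); §5 p.327 (PDF p.101) (Def. 5.4 (a) consumes it);
S. Mochizuki, *The geometry of Frobenioids II* (2008), Def. 2.1 (i) p.16; *The geometry of Frobenioids I* (2008), Thm. 5.2 (i) p.101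
(Frobenius-trivial objects `(A, 0)`).  [cite: MochizukiEtTh2009, Def 4.1 (iv) p.87]

PROOF-ONLY (theorems only; abc-iut cell, layer L2, seat abc-iut-L2-d2 gen 8; gen-7 HANDOFF open item (i) «EXISTS-MUSAT@FOURTH-MODEL»), at
this lineage's fourth tower model of record `ThetaTwistTowerTempered.temperedFrobenioid R S` (p493549).  Consumed BY NAME, nothing restated:
gen 7's `isMuSaturated_of_stabilizer_le_vSub` (p500836; ⟸ abc-iut-w6-d037's `isMuSaturated_of_bZero_generator` p496075), abc-iut-w5-d034's
covering `exists_cover_vSub` (`Y_n = Compat₃′/V_n`, level EXACTLY `n`, point-stabiliser abc-iut-L1-t6's `V_n`), [FrdI]'s generic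
Frobenius-trivial object `ModelFrobenioid.zeroObj` (`(Y, 0)`, the constructor abc-iut-L2-t3's `quotConnZeroObj` specialises).
* `isMuSaturated_zeroObj_of_stabilizer_le_vSub` — the object `(Y, 0)` over ANY connected covering `Y` with a point whose stabiliser lies in
  `V_m`, `m ≥ lvl Y`, is `μ_N`-saturated for every `N ∣ (lvl Y + 1)!`;
* **`exists_isMuSaturated_lvl n N (h : N ∣ (n+1)!)`** — a `μ_N`-saturated object of level EXACTLY `n` exists (`(Y_n, 0)`);
* **`exists_isMuSaturated N : ∃ A, IsMuSaturated A N`** for EVERY `N ≥ 1` (level `n := N`, `N ∣ (N+1)!`) — Def. 4.1 (iv) is INHABITED at a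
  tower model of record, in the ∃-form the §4/§5 consumers quantify over («for `N ∈ ℕ_{≥1}` … a `μ_N`-saturated `A`»);
* `exists_isMuSaturated_forall_dvd n : ∃ A, lvl A^bs = n ∧ ∀ N ∣ (n+1)!, IsMuSaturated A N` — ONE object saturated for all `N ∣ N_n` at once.
HONEST FRAMING: class-(b) design model (NOT the tempered Frobenioid of a Tate curve); an inhabitant at OUR model witnesses OUR binders only;
nothing here bears on [IUTchIII] Cor. 3.12; no side taken; typed ≠ proved.
-/

noncomputable section

namespace Literature.AnabelianGeometry.EtaleTheta

open CategoryTheory Opposite Function Literature.AlgebraicGeometry.Frobenioids Literature.AlgebraicGeometry.Frobenioids.QuasiTemperoid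
  Literature.AnabelianGeometry.SemiGraphs LogDivisorModel LogDivisorModel.GaloisAction LogDivisorTower

namespace ThetaTwistTowerTempered

open LogDivisorModel.TateTowerThetaTwist TateTowerKummerTwistRShear
open TateTowerKummerTwist (N N_dvd_M)

variable (R S : ((ConnectedPart (BTemp (Compat 3 thetaShear)))ᵒᵖ ⥤ CommMonCat.{0}) → Prop)

/-- The Frobenius-trivial object `(Y, 0)` of the fourth model over a connected covering `Y` ([FrdI] Thm. 5.2 (i); print's `A_⊙`-shape
objects). [cite: MochizukiFrdI2008, Thm 5.2 p.101] -/
theorem zeroObj_base (Y : ConnectedPart (BTemp (Compat 3 thetaShear))) :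
    (ModelFrobenioid.zeroObj (ThetaTwistTowerTempered.temperedFrobenioid R S).divisorMonoid
        (ThetaTwistTowerTempered.temperedFrobenioid R S).ratFnFunctor (ThetaTwistTowerTempered.temperedFrobenioid R S).divBNatTrans Y :
        (ThetaTwistTowerTempered.temperedFrobenioid R S).category).base = Y := rfl

/-- **`(Y, 0)` is `μ_N`-SATURATED whenever a point of `Y` has stabiliser inside abc-iut-L1-t6's `V_m`, `m ≥ lvl Y`, and `N ∣ (lvl Y + 1)!`**
(gen 7's `isMuSaturated_of_stabilizer_le_vSub` at the Frobenius-trivial object). [cite: MochizukiEtTh2009, Def 4.1 (iv) p.87] -/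
theorem isMuSaturated_zeroObj_of_stabilizer_le_vSub (Y : ConnectedPart (BTemp (Compat 3 thetaShear))) (y₀ : (gset Y).V) {m : ℕ}
    (hm : lvlC 3 thetaShear Y ≤ m) (hstab : ∀ g : Compat 3 thetaShear, (gset Y).ρ g y₀ = y₀ → g ∈ vSub 3 thetaShear m) (N : ℕ+)
    (hdvd : (N : ℕ) ∣ ((TateTowerKummerTwist.N (lvlC 3 thetaShear Y) : ℕ+) : ℕ)) :
    (ThetaTwistTowerTempered.temperedFrobenioid R S).IsMuSaturated
      (ModelFrobenioid.zeroObj (ThetaTwistTowerTempered.temperedFrobenioid R S).divisorMonoid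
        (ThetaTwistTowerTempered.temperedFrobenioid R S).ratFnFunctor (ThetaTwistTowerTempered.temperedFrobenioid R S).divBNatTrans Y) N :=
  isMuSaturated_of_stabilizer_le_vSub R S _ y₀ hm hstab N hdvd

/-- **A `μ_N`-saturated object of level EXACTLY `n` exists for every `N ∣ N_n = (n+1)!`**: `(Y_n, 0)` over abc-iut-w5-d034's covering
`Y_n = Compat₃′/V_n`. [cite: MochizukiEtTh2009, Def 4.1 (iv) p.87] -/
theorem exists_isMuSaturated_lvl (n : ℕ) (N : ℕ+) (hdvd : (N : ℕ) ∣ Nat.factorial (n + 1)) :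
    ∃ A : (ThetaTwistTowerTempered.temperedFrobenioid R S).category,
      lvlC 3 thetaShear A.base = n ∧ (ThetaTwistTowerTempered.temperedFrobenioid R S).IsMuSaturated A N := by
  obtain ⟨Y, y₀, hlvl, -, hstab, -⟩ := exists_cover_vSub n
  refine ⟨ModelFrobenioid.zeroObj _ _ _ Y, hlvl, isMuSaturated_zeroObj_of_stabilizer_le_vSub R S Y y₀ hlvl.le
    (fun g hg => (hstab g).1 hg) N ?_⟩
  rwa [hlvl, TateTowerKummerTwist.coe_N]

/-- **[EtTh] Def. 4.1 (iv) INHABITED at the fourth tower model: for EVERY `N ≥ 1` there is a `μ_N`-saturated object** (at level `N`,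
since `N ∣ (N+1)!`). [cite: MochizukiEtTh2009, Def 4.1 (iv) p.87] -/
theorem exists_isMuSaturated (N : ℕ+) :
    ∃ A : (ThetaTwistTowerTempered.temperedFrobenioid R S).category, (ThetaTwistTowerTempered.temperedFrobenioid R S).IsMuSaturated A N := by
  obtain ⟨A, -, hA⟩ := exists_isMuSaturated_lvl R S (N : ℕ) N (Nat.dvd_factorial N.pos (Nat.le_succ _))
  exact ⟨A, hA⟩

/-- **ONE object of level `n` is `μ_N`-saturated for ALL `N ∣ (n+1)!` simultaneously** (`(Y_n, 0)`; e.g. for both `N` and `l·N` of Def. 5.4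
once `l·N ∣ (n+1)!`). [cite: MochizukiEtTh2009, Def 4.1 (iv) p.87] -/
theorem exists_isMuSaturated_forall_dvd (n : ℕ) :
    ∃ A : (ThetaTwistTowerTempered.temperedFrobenioid R S).category, lvlC 3 thetaShear A.base = n ∧
      ∀ N : ℕ+, (N : ℕ) ∣ Nat.factorial (n + 1) → (ThetaTwistTowerTempered.temperedFrobenioid R S).IsMuSaturated A N := by
  obtain ⟨Y, y₀, hlvl, -, hstab, -⟩ := exists_cover_vSub n
  refine ⟨ModelFrobenioid.zeroObj _ _ _ Y, hlvl, fun N hdvd => isMuSaturated_zeroObj_of_stabilizer_le_vSub R S Y y₀ hlvl.le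
    (fun g hg => (hstab g).1 hg) N ?_⟩
  rwa [hlvl, TateTowerKummerTwist.coe_N]

/-- **Every level `n ≥ N − 1` carries a `μ_N`-saturated object** (`N ∣ (n+1)!` as soon as `N ≤ n+1`). [cite: MochizukiEtTh2009, Def 4.1 (iv) p.87] -/
theorem exists_isMuSaturated_lvl_of_le (N : ℕ+) (n : ℕ) (hn : (N : ℕ) ≤ n + 1) :
    ∃ A : (ThetaTwistTowerTempered.temperedFrobenioid R S).category,
      lvlC 3 thetaShear A.base = n ∧ (ThetaTwistTowerTempered.temperedFrobenioid R S).IsMuSaturated A N :=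
  exists_isMuSaturated_lvl R S n N (Nat.dvd_factorial N.pos hn)

end ThetaTwistTowerTempered

end Literature.AnabelianGeometry.EtaleTheta

end
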